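import Literature.Geometry.Lorentzian.SpacetimeLocalConvergence
import Literature.Analysis.Calculus.PointPushDiffeomorphism
import HarnessLib

/-!
# Point-pushing diffeomorphisms of a spacetime
(topic `Geometry/Lorentzian`; the manifold form of the Euclidean point push
`PointPushDiffeomorphism.lean`: Hirsch 1976, Ch. 8 §3; Milnor 1965, §4, Homogeneity Lemma — used to
re-base pointed `Cᵏ_loc` limits of spacetimes at nearby points, `SpacetimeLocalConvergence.lean`)

Fix a point `x₀` of a spacetime `𝓢` and its preferred chart `c = chartAt E4 x₀`. A **push datum**
(`PushData 𝓢 x₀`, always available: `pushData`) records a radius `R > 0` with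
`closedBall (c x₀) (3R) ⊆ c.target`, a smooth bump `χ` equal to `1` on `closedBall (c x₀) R` and
supported in `ball (c x₀) (2R)`, and a Lipschitz / derivative bound `L` for `χ`. For a vector
`v : E4` the **push** `P.push v : 𝓢 → 𝓢` is `c⁻¹ ∘ (y ↦ y + χ(y) • v) ∘ c` on the chart source and
the identity elsewhere. Main results:

* `push_apply_basepoint`: `P.push v x₀ = c⁻¹(c x₀ + v)` — it moves `x₀` to any prescribed nearby
  point (`push_apply_basepoint_of_eq`);
* `push_eq_self_of_not_mem`: it is the identity off the compact set `c⁻¹(closedBall (c x₀) (2R))`;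
* `contMDiff_push` (`‖v‖ < R`), and for ADMISSIBLE `v` (`‖v‖ < R`, `L ‖v‖ < 1`; all small `v` are,
  `eventually_admissible`) the push is a **diffeomorphism** of `𝓢` (`pushDiffeomorph`, inverse
  built from the inverse of the Euclidean push), hence injective and a local diffeomorphism
  everywhere (`injective_push`, `isLocalDiffeomorph_push`).

## References
* [Hirsch1976] M. W. Hirsch, *Differential Topology*, GTM 33, Springer 1976, Ch. 8, §3.
* [Milnor1965] J. Milnor, *Topology from the Differentiable Viewpoint*, 1965, §4.
-/

noncomputable section

open TopologicalSpace Manifold Filter Topology Set Function Metric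
open scoped ContDiff Topology NNReal
open Literature.Analysis.Calculus

universe u

namespace Literature.Geometry.Lorentzian

namespace Spacetime

variable (𝓢 : Spacetime.{u} 4) (x₀ : 𝓢.carrier)

/-- A **push datum** at `x₀`: radius, bump and Lipschitz bound in the preferred chart at `x₀`
(module docstring). [cite: Hirsch1976, Ch. 8 §3] -/
structure PushData where
  /-- The radius: `closedBall (c x₀) (3R) ⊆ c.target`. -/
  R : ℝ
  /-- The radius is positive. -/
  R_pos : 0 < R
  /-- The triple ball lies in the chart target. -/
  closedBall_subset : closedBall (chartAt E4 x₀ x₀) (3 * R) ⊆ (chartAt E4 x₀).target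
  /-- The bump, `= 1` on `closedBall (c x₀) R`, supported in `ball (c x₀) (2R)`. -/
  χ : ContDiffBump (chartAt E4 x₀ x₀)
  /-- Inner radius of the bump. -/
  χ_rIn : χ.rIn = R
  /-- Outer radius of the bump. -/
  χ_rOut : χ.rOut = 2 * R
  /-- A Lipschitz / derivative bound of the bump. -/
  L : ℝ≥0
  /-- `χ` is `L`-Lipschitz. -/
  lipschitz : LipschitzWith L (χ : E4 → ℝ)
  /-- `‖Dχ‖ ≤ L` everywhere. -/
  norm_fderiv_le : ∀ y, ‖fderiv ℝ (χ : E4 → ℝ) y‖ ≤ L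

/-- **Push data exist at every point.** [folklore] -/
theorem nonempty_pushData : Nonempty (PushData 𝓢 x₀) := by
  obtain ⟨r, hr, hrt⟩ := Metric.nhds_basis_closedBall.mem_iff.1
    ((chartAt E4 x₀).open_target.mem_nhds (mem_chart_target E4 x₀))
  set R : ℝ := r / 3 with hR
  have hRpos : 0 < R := by positivity
  let χ : ContDiffBump (chartAt E4 x₀ x₀) := ⟨R, 2 * R, hRpos, by linarith⟩
  obtain ⟨L, hL, hDL⟩ := exists_lipschitz_bound_bump χ
  refine ⟨⟨R, hRpos, ?_, χ, rfl, rfl, L, hL, hDL⟩⟩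
  have h3 : 3 * R = r := by rw [hR]; ring
  rw [h3]; exact hrt

/-- A chosen push datum at `x₀`. [folklore] -/
def pushData : PushData 𝓢 x₀ := (nonempty_pushData 𝓢 x₀).some

namespace PushData

variable {𝓢 x₀} (P : PushData 𝓢 x₀)

/-- `χ = 1` on the inner ball. [folklore] -/
theorem χ_eq_one {y : E4} (hy : dist y (chartAt E4 x₀ x₀) ≤ P.R) : (P.χ : E4 → ℝ) y = 1 :=
  P.χ.one_of_mem_closedBall (by rw [mem_closedBall, P.χ_rIn]; exact hy)

/-- `χ = 0` off the outer ball. [folklore] -/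
theorem χ_eq_zero {y : E4} (hy : 2 * P.R ≤ dist y (chartAt E4 x₀ x₀)) : (P.χ : E4 → ℝ) y = 0 :=
  P.χ.zero_of_le_dist (by rw [P.χ_rOut]; exact hy)

/-- **Admissible push vectors**: `‖v‖ < R` and `L ‖v‖ < 1`. [folklore] -/
def Admissible (v : E4) : Prop := ‖v‖ < P.R ∧ P.L * ‖v‖₊ < 1

/-- All small vectors are admissible. [folklore] -/
theorem eventually_admissible : ∀ᶠ v in 𝓝 (0 : E4), P.Admissible v := by
  have h1 : ∀ᶠ v in 𝓝 (0 : E4), ‖v‖ < P.R := by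
    have := Metric.ball_mem_nhds (0 : E4) P.R_pos
    filter_upwards [this] with v hv
    simpa using hv
  have h2 : ∀ᶠ v in 𝓝 (0 : E4), (P.L : ℝ) * ‖v‖ < 1 := by
    have hc : Continuous fun v : E4 ↦ (P.L : ℝ) * ‖v‖ := continuous_const.mul continuous_norm
    have h0 : (fun v : E4 ↦ (P.L : ℝ) * ‖v‖) 0 < 1 := by simp
    exact hc.continuousAt.eventually (gt_mem_nhds h0)
  filter_upwards [h1, h2] with v hv1 hv2
  refine ⟨hv1, ?_⟩
  rw [← NNReal.coe_lt_coe, NNReal.coe_mul, coe_nnnorm]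
  exact hv2

/-- The Euclidean push of the datum. [folklore] -/
def θ (v : E4) : E4 → E4 := pointPush P.χ v

/-- The Euclidean push is the identity off the outer ball (for every `v`). [folklore] -/
theorem θ_eq_self {v y : E4} (hy : 2 * P.R ≤ dist y (chartAt E4 x₀ x₀)) : P.θ v y = y :=
  pointPush_apply_of_eq_zero (P.χ_eq_zero hy) v

/-- At the centre the Euclidean push is the translation by `v`. [folklore] -/
theorem θ_centre (v : E4) : P.θ v (chartAt E4 x₀ x₀) = chartAt E4 x₀ x₀ + v :=
  pointPush_apply_of_eq_one (P.χ_eq_one (by simp [P.R_pos.le])) v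

/-- For `‖v‖ < R` the Euclidean push maps the chart target into itself (it moves points of the
outer ball by less than `R`, inside the triple ball). [folklore] -/
theorem θ_mem_target {v : E4} (hv : ‖v‖ < P.R) {y : E4} (hy : y ∈ (chartAt E4 x₀).target) :
    P.θ v y ∈ (chartAt E4 x₀).target := by
  by_cases h : 2 * P.R ≤ dist y (chartAt E4 x₀ x₀)
  · rw [P.θ_eq_self h]; exact hy
  · refine P.closedBall_subset (mem_closedBall.2 ?_)
    have hχ : |(P.χ : E4 → ℝ) y| ≤ 1 := by
      rw [abs_of_nonneg P.χ.nonneg]; exact P.χ.le_one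
    calc dist (P.θ v y) (chartAt E4 x₀ x₀)
        ≤ dist (P.θ v y) y + dist y (chartAt E4 x₀ x₀) := dist_triangle _ _ _
      _ = ‖(P.χ : E4 → ℝ) y • v‖ + dist y (chartAt E4 x₀ x₀) := by
          rw [dist_eq_norm]; simp [θ]
      _ ≤ ‖v‖ + 2 * P.R := by
          rw [norm_smul, Real.norm_eq_abs]
          exact add_le_add (mul_le_of_le_one_left (norm_nonneg v) hχ) (not_le.1 h).le
      _ ≤ 3 * P.R := by linarith

/-- The Euclidean push moves points by at most `‖v‖`; in particular the outer CLOSED ball is mapped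
into the chart target when `‖v‖ < R`. [folklore] -/
theorem θ_mem_target_of_mem_closedBall {v : E4} (hv : ‖v‖ < P.R) {y : E4}
    (hy : y ∈ closedBall (chartAt E4 x₀ x₀) (2 * P.R)) : P.θ v y ∈ (chartAt E4 x₀).target :=
  P.θ_mem_target hv (P.closedBall_subset (closedBall_subset_closedBall (by linarith [P.R_pos]) hy))

/-- The inverse Euclidean push (admissible `v`). [folklore] -/
def θinv {v : E4} (hv : P.Admissible v) : E4 → E4 := (pointPushHomeomorph P.lipschitz hv.2).symm

/-- `θinv ∘ θ = id`. [folklore] -/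
theorem θinv_θ {v : E4} (hv : P.Admissible v) (y : E4) : P.θinv hv (P.θ v y) = y :=
  pointPushHomeomorph_symm_apply_pointPush P.lipschitz hv.2 y

/-- `θ ∘ θinv = id`. [folklore] -/
theorem θ_θinv {v : E4} (hv : P.Admissible v) (y : E4) : P.θ v (P.θinv hv y) = y :=
  pointPush_pointPushHomeomorph_symm_apply P.lipschitz hv.2 y

/-- The inverse Euclidean push is the identity off the outer ball. [folklore] -/
theorem θinv_eq_self {v : E4} (hv : P.Admissible v) {y : E4}
    (hy : 2 * P.R ≤ dist y (chartAt E4 x₀ x₀)) : P.θinv hv y = y :=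
  pointPushHomeomorph_symm_apply_of_eq_zero P.lipschitz hv.2 (P.χ_eq_zero hy)

/-- The inverse Euclidean push maps the chart target into itself. [folklore] -/
theorem θinv_mem_target {v : E4} (hv : P.Admissible v) {y : E4} (hy : y ∈ (chartAt E4 x₀).target) :
    P.θinv hv y ∈ (chartAt E4 x₀).target := by
  by_cases h : 2 * P.R ≤ dist (P.θinv hv y) (chartAt E4 x₀ x₀)
  · have : P.θinv hv y = y := by
      have h1 := P.θ_eq_self (v := v) h
      rw [P.θ_θinv hv] at h1
      exact h1.symm
    rw [this]; exact hy
  · exact P.closedBall_subset (closedBall_subset_closedBall (by linarith [P.R_pos])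
      (mem_closedBall.2 (not_le.1 h).le))

/-- The Euclidean push is smooth. [folklore] -/
theorem contDiff_θ (v : E4) : ContDiff ℝ ∞ (P.θ v) := contDiff_pointPush P.χ.contDiff v

/-- The inverse Euclidean push is smooth. [folklore] -/
theorem contDiff_θinv {v : E4} (hv : P.Admissible v) : ContDiff ℝ ∞ (P.θinv hv) :=
  contDiff_pointPush_symm (by simp) P.χ.contDiff P.lipschitz P.norm_fderiv_le hv.2

/-! ### The push on the spacetime -/

/-- **The push** `c⁻¹ ∘ θ_v ∘ c` on the chart source, the identity elsewhere. [cite: Hirsch1976, Ch. 8 §3] -/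
def push (v : E4) : 𝓢.carrier → 𝓢.carrier := fun q ↦ by
  classical
  exact if q ∈ (chartAt E4 x₀).source then (chartAt E4 x₀).symm (P.θ v (chartAt E4 x₀ q)) else q

/-- The inverse push (admissible `v`). [folklore] -/
def pushInv {v : E4} (hv : P.Admissible v) : 𝓢.carrier → 𝓢.carrier := fun q ↦ by
  classical
  exact if q ∈ (chartAt E4 x₀).source then (chartAt E4 x₀).symm (P.θinv hv (chartAt E4 x₀ q)) else q

/-- The push on the chart source. [folklore] -/
theorem push_apply_of_mem {v : E4} {q : 𝓢.carrier} (hq : q ∈ (chartAt E4 x₀).source) :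
    P.push v q = (chartAt E4 x₀).symm (P.θ v (chartAt E4 x₀ q)) := by
  classical
  simp [push, hq]

/-- The push off the chart source. [folklore] -/
theorem push_apply_of_not_mem {v : E4} {q : 𝓢.carrier} (hq : q ∉ (chartAt E4 x₀).source) :
    P.push v q = q := by
  classical
  simp [push, hq]

/-- The inverse push on the chart source. [folklore] -/
theorem pushInv_apply_of_mem {v : E4} (hv : P.Admissible v) {q : 𝓢.carrier}
    (hq : q ∈ (chartAt E4 x₀).source) :
    P.pushInv hv q = (chartAt E4 x₀).symm (P.θinv hv (chartAt E4 x₀ q)) := by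
  classical
  simp [pushInv, hq]

/-- The inverse push off the chart source. [folklore] -/
theorem pushInv_apply_of_not_mem {v : E4} (hv : P.Admissible v) {q : 𝓢.carrier}
    (hq : q ∉ (chartAt E4 x₀).source) : P.pushInv hv q = q := by
  classical
  simp [pushInv, hq]

/-- **The push moves the base point**: `push v x₀ = c⁻¹(c x₀ + v)`. [cite: Milnor1965, §4] -/
theorem push_apply_basepoint (v : E4) :
    P.push v x₀ = (chartAt E4 x₀).symm (chartAt E4 x₀ x₀ + v) := by
  rw [P.push_apply_of_mem (mem_chart_source E4 x₀), P.θ_centre]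

/-- For a point `x` of the chart source, pushing by `v = c x − c x₀` moves `x₀` to `x`. [cite: Milnor1965, §4] -/
theorem push_apply_basepoint_of_mem {x : 𝓢.carrier} (hx : x ∈ (chartAt E4 x₀).source) :
    P.push (chartAt E4 x₀ x - chartAt E4 x₀ x₀) x₀ = x := by
  rw [P.push_apply_basepoint, add_sub_cancel, (chartAt E4 x₀).left_inv hx]

/-- The push maps the chart source into itself (`‖v‖ < R`). [folklore] -/
theorem push_mem_source {v : E4} (hv : ‖v‖ < P.R) {q : 𝓢.carrier}
    (hq : q ∈ (chartAt E4 x₀).source) : P.push v q ∈ (chartAt E4 x₀).source := by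
  rw [P.push_apply_of_mem hq]
  exact (chartAt E4 x₀).map_target (P.θ_mem_target hv ((chartAt E4 x₀).map_source hq))

/-- The inverse push maps the chart source into itself. [folklore] -/
theorem pushInv_mem_source {v : E4} (hv : P.Admissible v) {q : 𝓢.carrier}
    (hq : q ∈ (chartAt E4 x₀).source) : P.pushInv hv q ∈ (chartAt E4 x₀).source := by
  rw [P.pushInv_apply_of_mem hv hq]
  exact (chartAt E4 x₀).map_target (P.θinv_mem_target hv ((chartAt E4 x₀).map_source hq))

/-- `pushInv ∘ push = id`. [folklore] -/
theorem pushInv_push {v : E4} (hv : P.Admissible v) (q : 𝓢.carrier) :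
    P.pushInv hv (P.push v q) = q := by
  by_cases hq : q ∈ (chartAt E4 x₀).source
  · rw [P.pushInv_apply_of_mem hv (P.push_mem_source hv.1 hq), P.push_apply_of_mem hq,
      (chartAt E4 x₀).right_inv (P.θ_mem_target hv.1 ((chartAt E4 x₀).map_source hq)),
      P.θinv_θ hv, (chartAt E4 x₀).left_inv hq]
  · rw [P.push_apply_of_not_mem hq, P.pushInv_apply_of_not_mem hv hq]

/-- `push ∘ pushInv = id`. [folklore] -/
theorem push_pushInv {v : E4} (hv : P.Admissible v) (q : 𝓢.carrier) :
    P.push v (P.pushInv hv q) = q := by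
  by_cases hq : q ∈ (chartAt E4 x₀).source
  · rw [P.push_apply_of_mem (P.pushInv_mem_source hv hq), P.pushInv_apply_of_mem hv hq,
      (chartAt E4 x₀).right_inv (P.θinv_mem_target hv ((chartAt E4 x₀).map_source hq)),
      P.θ_θinv hv, (chartAt E4 x₀).left_inv hq]
  · rw [P.pushInv_apply_of_not_mem hv hq, P.push_apply_of_not_mem hq]

/-- The **support set** of the pushes: `c⁻¹(closedBall (c x₀) (2R))`, compact. [folklore] -/
def supportSet : Set 𝓢.carrier := (chartAt E4 x₀).symm '' closedBall (chartAt E4 x₀ x₀) (2 * P.R)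

/-- The support set is compact. [folklore] -/
theorem isCompact_supportSet : IsCompact P.supportSet :=
  (isCompact_closedBall _ _).image_of_continuousOn ((chartAt E4 x₀).continuousOn_symm.mono
    (P.closedBall_subset.trans' (closedBall_subset_closedBall (by linarith [P.R_pos]))))

/-- The support set lies in the chart source. [folklore] -/
theorem supportSet_subset_source : P.supportSet ⊆ (chartAt E4 x₀).source := by
  rintro _ ⟨y, hy, rfl⟩
  exact (chartAt E4 x₀).map_target
    (P.closedBall_subset (closedBall_subset_closedBall (by linarith [P.R_pos]) hy))

/-- A point of the chart source outside the support set has chart image off the outer ball.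
[folklore] -/
theorem two_mul_R_le_dist_of_not_mem_supportSet {q : 𝓢.carrier} (hq : q ∉ P.supportSet)
    (hqs : q ∈ (chartAt E4 x₀).source) : 2 * P.R ≤ dist (chartAt E4 x₀ q) (chartAt E4 x₀ x₀) := by
  by_contra h
  exact hq ⟨chartAt E4 x₀ q, mem_closedBall.2 (not_le.1 h).le, (chartAt E4 x₀).left_inv hqs⟩

/-- **Off the support set the push is the identity** (every `v`). [folklore] -/
theorem push_eq_self_of_not_mem {v : E4} {q : 𝓢.carrier} (hq : q ∉ P.supportSet) :
    P.push v q = q := by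
  by_cases hqs : q ∈ (chartAt E4 x₀).source
  · rw [P.push_apply_of_mem hqs, P.θ_eq_self (P.two_mul_R_le_dist_of_not_mem_supportSet hq hqs),
      (chartAt E4 x₀).left_inv hqs]
  · exact P.push_apply_of_not_mem hqs

/-- Off the support set the inverse push is the identity. [folklore] -/
theorem pushInv_eq_self_of_not_mem {v : E4} (hv : P.Admissible v) {q : 𝓢.carrier}
    (hq : q ∉ P.supportSet) : P.pushInv hv q = q := by
  by_cases hqs : q ∈ (chartAt E4 x₀).source
  · rw [P.pushInv_apply_of_mem hv hqs,
      P.θinv_eq_self hv (P.two_mul_R_le_dist_of_not_mem_supportSet hq hqs),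
      (chartAt E4 x₀).left_inv hqs]
  · exact P.pushInv_apply_of_not_mem hv hqs

/-- Near a point off the support set, the push is the identity (the support set is closed).
[folklore] -/
theorem push_eventuallyEq_id {v : E4} {q : 𝓢.carrier} (hq : q ∉ P.supportSet) :
    P.push v =ᶠ[𝓝 q] id := by
  have hopen : IsOpen P.supportSetᶜ := P.isCompact_supportSet.isClosed.isOpen_compl
  filter_upwards [hopen.mem_nhds hq] with q' hq'
  exact P.push_eq_self_of_not_mem hq'

/-- Near a point off the support set, the inverse push is the identity. [folklore] -/
theorem pushInv_eventuallyEq_id {v : E4} (hv : P.Admissible v) {q : 𝓢.carrier}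
    (hq : q ∉ P.supportSet) : P.pushInv hv =ᶠ[𝓝 q] id := by
  have hopen : IsOpen P.supportSetᶜ := P.isCompact_supportSet.isClosed.isOpen_compl
  filter_upwards [hopen.mem_nhds hq] with q' hq'
  exact P.pushInv_eq_self_of_not_mem hv hq'

/-- Near a point of the chart source, the push is `c⁻¹ ∘ θ ∘ c`. [folklore] -/
theorem push_eventuallyEq_comp {v : E4} {q : 𝓢.carrier} (hq : q ∈ (chartAt E4 x₀).source) :
    P.push v =ᶠ[𝓝 q] (chartAt E4 x₀).symm ∘ P.θ v ∘ chartAt E4 x₀ := by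
  filter_upwards [(chartAt E4 x₀).open_source.mem_nhds hq] with q' hq'
  exact P.push_apply_of_mem hq'

/-- Near a point of the chart source, the inverse push is `c⁻¹ ∘ θ⁻¹ ∘ c`. [folklore] -/
theorem pushInv_eventuallyEq_comp {v : E4} (hv : P.Admissible v) {q : 𝓢.carrier}
    (hq : q ∈ (chartAt E4 x₀).source) :
    P.pushInv hv =ᶠ[𝓝 q] (chartAt E4 x₀).symm ∘ P.θinv hv ∘ chartAt E4 x₀ := by
  filter_upwards [(chartAt E4 x₀).open_source.mem_nhds hq] with q' hq'
  exact P.pushInv_apply_of_mem hv hq'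

/-- **The push is smooth** (`‖v‖ < R`). [cite: Hirsch1976, Ch. 8 §3] -/
theorem contMDiff_push {v : E4} (hv : ‖v‖ < P.R) : ContMDiff (𝓡 4) (𝓡 4) ∞ (P.push v) := by
  intro q
  by_cases hq : q ∈ (chartAt E4 x₀).source
  · refine ContMDiffAt.congr_of_eventuallyEq ?_ (P.push_eventuallyEq_comp hq)
    have h1 : ContMDiffAt (𝓡 4) 𝓘(ℝ, E4) ∞ (chartAt E4 x₀) q :=
      (contMDiffOn_chart (x := x₀)).contMDiffAt ((chartAt E4 x₀).open_source.mem_nhds hq)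
    have h2 : ContMDiffAt 𝓘(ℝ, E4) 𝓘(ℝ, E4) ∞ (P.θ v) (chartAt E4 x₀ q) :=
      (P.contDiff_θ v).contMDiff.contMDiffAt
    have h3 : ContMDiffAt 𝓘(ℝ, E4) (𝓡 4) ∞ (chartAt E4 x₀).symm (P.θ v (chartAt E4 x₀ q)) :=
      (contMDiffOn_chart_symm (x := x₀)).contMDiffAt ((chartAt E4 x₀).open_target.mem_nhds
        (P.θ_mem_target hv ((chartAt E4 x₀).map_source hq)))
    exact h3.comp q (h2.comp q h1)
  · exact contMDiffAt_id.congr_of_eventuallyEq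
      (P.push_eventuallyEq_id fun h ↦ hq (P.supportSet_subset_source h))

/-- The inverse push is smooth. [cite: Hirsch1976, Ch. 8 §3] -/
theorem contMDiff_pushInv {v : E4} (hv : P.Admissible v) : ContMDiff (𝓡 4) (𝓡 4) ∞ (P.pushInv hv) := by
  intro q
  by_cases hq : q ∈ (chartAt E4 x₀).source
  · refine ContMDiffAt.congr_of_eventuallyEq ?_ (P.pushInv_eventuallyEq_comp hv hq)
    have h1 : ContMDiffAt (𝓡 4) 𝓘(ℝ, E4) ∞ (chartAt E4 x₀) q :=
      (contMDiffOn_chart (x := x₀)).contMDiffAt ((chartAt E4 x₀).open_source.mem_nhds hq)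
    have h2 : ContMDiffAt 𝓘(ℝ, E4) 𝓘(ℝ, E4) ∞ (P.θinv hv) (chartAt E4 x₀ q) :=
      (P.contDiff_θinv hv).contMDiff.contMDiffAt
    have h3 : ContMDiffAt 𝓘(ℝ, E4) (𝓡 4) ∞ (chartAt E4 x₀).symm (P.θinv hv (chartAt E4 x₀ q)) :=
      (contMDiffOn_chart_symm (x := x₀)).contMDiffAt ((chartAt E4 x₀).open_target.mem_nhds
        (P.θinv_mem_target hv ((chartAt E4 x₀).map_source hq)))
    exact h3.comp q (h2.comp q h1)
  · exact contMDiffAt_id.congr_of_eventuallyEq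
      (P.pushInv_eventuallyEq_id hv fun h ↦ hq (P.supportSet_subset_source h))

/-- **The push is a diffeomorphism of the spacetime** (admissible `v`). [cite: Hirsch1976, Ch. 8 §3] -/
def pushDiffeomorph {v : E4} (hv : P.Admissible v) :
    Diffeomorph (𝓡 4) (𝓡 4) 𝓢.carrier 𝓢.carrier ∞ where
  toFun := P.push v
  invFun := P.pushInv hv
  left_inv := P.pushInv_push hv
  right_inv := P.push_pushInv hv
  contMDiff_toFun := P.contMDiff_push hv.1
  contMDiff_invFun := P.contMDiff_pushInv hv

/-- The diffeomorphism is the push. [folklore] -/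
@[simp]
theorem pushDiffeomorph_coe {v : E4} (hv : P.Admissible v) : ⇑(P.pushDiffeomorph hv) = P.push v :=
  rfl

/-- The push is injective (admissible `v`). [folklore] -/
theorem injective_push {v : E4} (hv : P.Admissible v) : Injective (P.push v) :=
  (P.pushDiffeomorph hv).injective

/-- The push is a local diffeomorphism everywhere (admissible `v`). [folklore] -/
theorem isLocalDiffeomorph_push {v : E4} (hv : P.Admissible v) :
    IsLocalDiffeomorph (𝓡 4) (𝓡 4) ∞ (P.push v) := by
  have h := (P.pushDiffeomorph hv).isLocalDiffeomorph
  rwa [pushDiffeomorph_coe] at h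

end PushData

end Spacetime

end Literature.Geometry.Lorentzian
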